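import Summits.QuantumFields.BalabanUV.Beta.D1BFx.RWeightedLegPackReadout
import Summits.QuantumFields.BalabanUV.Beta.D1BFx.RWeightedLegPackSymm
import Summits.QuantumFields.BalabanUV.Beta.FP.CompositeMinimiserDecay

/-!
# `BalabanUV.Beta.D1BFx.RestLegEnvelopes` — road «BF-x» for binder row D1, slot (K), DICT-CHAIN-SPEC §2 (II): **THE LEG LETTERS OF THE
# REST-KERNEL UNIT ROWS ARE TREE THEOREMS** («RK-LEG-ENV»; FINDING F-d1leaf01-g20-2 «ENV-IN-TREE») — the n-UNIFORM envelopes of the three block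
# species of the road's packed N-leg `NlegRoad m a` (blocking `n = m + 1`), with EXPLICIT powers of `n`, BY NAME:
# «CUN-ENV» the coarse multiplier `Cun′ = multM n (2a∕n⁸) 2` and the mm block (`= −wΦ^{(n)}` on `n•ℤ⁴`): power `n⁻⁸`, UNCONDITIONAL;
# «WH-ENV» the fm ∕ mf blocks (`ℋ_R = wH^{(n)}` columns): power `n⁻⁵ = n^{−(d+2)}`, decay on the block scale, modulo `h12 ∧ h126` (the read-out's hypotheses only)

HONEST DEPENDENCY (cell records, verbatim): «continuum YM on T⁴ ⇐ BetaPertH ∧ nine spine estimates (0/9 proved); BetaPertH ⇐ (D1) ∧ (D4) ∧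
CAP+tail; G-an2-4 gates asym, D1 and NE2/3/4.»  HONEST FRAMING (cell contract, verbatim): «discharging `BetaPertH` makes Bałaban's UV stability
UNCONDITIONAL — a real constructive-QFT result; it is NOT the continuum limit and NOT the Clay problem.»  THIS MODULE DISCHARGES NOTHING of the
wall: [folklore] composition BY NAME of LANDED theorems — typer T3's `CoarseLeg.decays_Cun` ∕ `CoarseLegJunction.abs_wΦ_le` (the (1.66) block action
kernel, d-only constants `c166Z 3`, `kappaZ 3`), the OWNER's `CoarseGramInverse.multM_road_eq_Cun`, ne9-leaf-06's `RWeightedLegPack*` (entries,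
off-lattice zeros, `trK_NlegRoad`, the read-out `NlegRoad_inl_inr_coarse`), d1-formalise-leaf-05's `FP.CompositeMinimiserDecay.abs_wH_le` (the minimiser
kernel `wH^{(N)}`, every `N ≥ 1`, d-only constants `MG163`, `kappa163`, `periodConst`, NO printed hypothesis), `T4GaugeActionRatePair.l1_le_mul_supNorm`,
`KernelSpecInstance.l1_le_l1_quo`.  No definition, no `def … : Prop`, nothing cited, 0 sorry.  The two printed [B5] statements `h12 ∧ h126` enter ONLY
§3–§4 and ONLY through the read-out `RWeightedLegPack.NlegRoad_inl_inr_coarse` (its own hypotheses, for `Spr (Ga (m+1) a)`); §1–§2 are UNCONDITIONAL.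
NO unit-class ROW is proved here (the (1.22) counts per rest word remain OPEN); this file supplies their LEG LETTERS.  0 root-level binders of row D1
discharged; (K) NOT closed; NOT D1, NOT `BetaPertH`, NOT continuum, NOT Clay.

ABSOLUTE RULE (cell charter, verbatim): «No internally-minted statement may enter as a cited fact. Every hypothesis is either kernel-proved in
this package or a verbatim quotation of a PUBLISHED theorem with page reference. The manuscript(s) under audit are NOT citable for their own
disputed steps — they are the thing under adjudication; programme-internal (2001/route/tribunal) claims are never citable.»

WHY (`HOME/b2b-balaban-beta-d1-p2/DICT-CHAIN-SPEC.md` v1.2 §2 (II), §3 (e), §7 «CUN-ENV» ∕ «WH-ENV»: «the TWO LEG LETTERS every (II) row needs … NOT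
in tree … Q-ENV to an5∕an4»).  By reading the tree both letters ARE landed theorems with explicit, n-uniform constants: the coarse multiplier is
`n⁻⁸·Cun n a` (`multM_road_eq_Cun`) and `Cun n a` decays with d-only constants (`decays_Cun`); the minimiser kernel `wH^{(n)}` — the fm block of the
road's N-leg by the read-out `NlegRoad_inl_inr_coarse` — obeys road FP's de-periodised torus certificate `abs_wH_le` with the unit `n^{−(d+2)}` of one
contour bond and decay `e^{−(κ₁₆₃(4)∕4)‖⌊x∕n⌋ − y₀‖∞}` on the block scale.  This file states them in the road's `NlegRoad` ∕ `blk` ∕ `Decays`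
currency so that the RK-BLK rows (3 tadpoles + 15 bi-bubbles of `RestKernelWords.blockWord (NlegRoad m a) …`) read their `ℋ_R` ∕ `ℋ♭_R` ∕ multiplier
legs BY NAME, and RK-SAND's sandwich leg `Ga𝒬ᵀCun′𝒬Ga = ℋ_R ∘ 𝒬 ∘ Ga` is one composition away («SAND-ENV», not here).

CONTENT (`n = m + 1`; `κ′ := kappa163 4 ∕ 4`; `C₄ := MG163 4 · periodConst (kappa163 4) 3`).
* §1 [folklore] «CUN-ENV»: **`abs_multM_road_le`**, **`decays_multM_road`** — `Decays (multM (m+1) (2a∕(m+1)⁸) 2) ((m+1)⁻⁸·(c166Z 3 + |a|)) (kappaZ 3)`.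
* §2 [folklore] THE mm BLOCK: `NlegK_inr_inr` (`= 2·embC n (a′•idK − Cm)`, every pack), **`NlegRoad_inr_inr_coarse`** (`= −wΦ^{(n)} m′ l (y − y′)` at coarse points),
  `abs_NlegRoad_inr_inr_coarse_le` (`≤ 2·n⁻⁸·c166Z 3·e^{−kappaZ 3·|y − y′|₁}`), **`decays_blk_NlegRoad_mm`** — `Decays (blk (NlegRoad m a) false false) (2·n⁻⁸·c166Z 3) (kappaZ 3 ∕ n)`.
* §3 [folklore] THE fm BLOCK (mod `h12 ∧ h126`): **`abs_NlegRoad_inl_inr_coarse_le`** (`|NlegRoad m a x (n•y₀) (inl κ) (inr l)| ≤ n⁻⁵·C₄·e^{−κ′·‖⌊x∕n⌋ − y₀‖∞}` —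
  `abs_wH_le` verbatim through the read-out), the `ℓ¹`∕fine-point form **`abs_NlegRoad_inl_inr_le`** (`≤ n⁻⁵·C₄·e^{κ′}·e^{−(κ′∕(4n))·|x − w|₁}` for EVERY `w`,
  zero off `n•ℤ⁴`), **`decays_blk_NlegRoad_fm`** — `Decays (blk (NlegRoad m a) true false) (n⁻⁵·C₄·e^{κ′}) (κ′∕(4n))`.
* §4 [folklore] THE mf BLOCK by symmetry (`trK_NlegRoad`): **`decays_blk_NlegRoad_mf`**.
NOT HERE (honest): the ff block `½(Ga − Ga𝒬ᵀCun′𝒬Ga)` and the sandwich leg («SAND-ENV»: needs the `h12` PROFILE of `Ga`, `GluonLegProfile.exists_abs_Ga_le_profile`,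
composed through the finite `𝒬`-leg sum); any (1.22) row.
Unit `b2b-balaban-beta-d1-formalise-leaf-01` (gen 20), D1 formalisation swarm leaf prover 01, road «BF-x»; INTENT 2 «RK-LEG-ENV» (journal).
-/

noncomputable section

open Literature.Probability.LatticeModels (Torus.proj)
open Literature.MathematicalPhysics.QuantumFieldTheory.LatticeForm (quo)
open Literature.MathematicalPhysics.QuantumFieldTheory.Balaban1983to89
open Literature.MathematicalPhysics.QuantumFieldTheory.Balaban1983to89.Beta
open B12Sec2to5 (l1 l1_nonneg)
open B4ContourShift (supNorm)
open B5Hk163Strip (kappa163 kappa163_pos)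
open B5Hk163Decay (MG163)
open B4TorusKernel (periodConst)
open T4GaugeActionRatePair (l1_le_mul_supNorm)
open ExpKernelCalculus (Site MKer Decays l1_sub_symm)
open HessKerSchurResolvent (idK idK_apply)
open KernelSpecInstance (wH wΦ l1_le_l1_quo)
open OneStepResolventKernel (Fib eq_zsmul_quo_of_proj quo_zsmul proj_zsmul)
open BlochFibreUniqueness (quo_add_zsmul)
open VectorTailsLoc (fam kfam)
open Summit.QuantumFields.BalabanUV.Beta.TameKernelCalculus (Spr trK trK_apply)
open Summit.QuantumFields.BalabanUV.Beta.D1BFx.PackedKernelSplit (blk)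
open Summit.QuantumFields.BalabanUV.Beta.D1BFx.CoarseLeg (Cun decays_Cun)
open Summit.QuantumFields.BalabanUV.Beta.D1BFx.CoarseLegJunction (abs_wΦ_le)
open Summit.QuantumFields.BalabanUV.Beta.D1BFx.CoarseGramInverse (multM multM_apply multM_road_eq_Cun)
open Summit.QuantumFields.BalabanUV.Beta.GAN24.DirichletExhaustionDeltaZ (c166Z kappaZ kappaZ_pos)
open Summit.QuantumFields.BalabanUV.Beta.D1BFx.RWeightedLegPack (embC embC_coarse Gp Qp Cp HRp HRbp sandP NlegK NlegRoad Gp_inr_inr Cp_inr_inr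
  comp_inr_row_off comp_inr_col_off NlegRoad_inr_row_off NlegRoad_inr_col_off l1_sub_of_proj NlegRoad_inl_inr_coarse trK_NlegRoad)
open Summit.QuantumFields.BalabanUV.Beta.D1BFx.GluonLegTails (spr_Ga_of_prop12)
open Summit.QuantumFields.BalabanUV.Beta.D1BFx.FrozenLegTails (nOf MOf hn1)
open Summit.QuantumFields.BalabanUV.Beta.FP.PeriodicTransportSum (quotOf)
open Summit.QuantumFields.BalabanUV.Beta.FP.CompositeMinimiserDecay (abs_wH_le)

namespace Summit.QuantumFields.BalabanUV.Beta.D1BFx.RestLegEnvelopes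

/-! ## §1 «CUN-ENV»: the coarse multiplier of the road decays with d-only constants, times `n⁻⁸` -/

section Cun

variable (m : ℕ) (a : ℝ)

/-- [folklore] **«CUN-ENV», ENTRYWISE**: `|multM (m+1) (2a∕(m+1)⁸) 2 y y′ m′ l| ≤ (m+1)⁻⁸·(c166Z 3 + |a|)·e^{−kappaZ 3·|y − y′|₁}` — the OWNER's
`multM_road_eq_Cun` (`Cun′ = n⁻⁸·Cun`) and typer T3's `CoarseLeg.decays_Cun` (d-only constants). -/
theorem abs_multM_road_le (y y' : Fin 4 → ℤ) (m' l : Fin 4) :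
    |multM (m + 1) (2 * a / ((m + 1 : ℕ) : ℝ) ^ 8) 2 y y' m' l|
      ≤ (((m + 1 : ℕ) : ℝ) ^ 8)⁻¹ * (c166Z 3 + |a|) * Real.exp (-(kappaZ 3) * l1 (y - y')) := by
  rw [multM_road_eq_Cun, abs_mul, abs_of_nonneg (by positivity : (0 : ℝ) ≤ (((m + 1 : ℕ) : ℝ) ^ 8)⁻¹), mul_assoc]
  exact mul_le_mul_of_nonneg_left (decays_Cun (m + 1) a y y' m' l) (by positivity)

/-- [folklore] **«CUN-ENV»**: `Decays (multM (m+1) (2a∕(m+1)⁸) 2) ((m+1)⁻⁸·(c166Z 3 + |a|)) (kappaZ 3)` — n-uniform rate on the unit lattice, power `n⁻⁸`. -/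
theorem decays_multM_road :
    Decays (multM (m + 1) (2 * a / ((m + 1 : ℕ) : ℝ) ^ 8) 2) ((((m + 1 : ℕ) : ℝ) ^ 8)⁻¹ * (c166Z 3 + |a|)) (kappaZ 3) :=
  fun y y' m' l => abs_multM_road_le m a y y' m' l

end Cun

/-! ## §2 The mm block of the N-leg: `−wΦ^{(n)}` on the sublattice, power `n⁻⁸` -/

section MM

variable (n : ℕ) [NeZero n] {Ga Cm : MKer 4 (Fin 4)}

omit [NeZero n] in
/-- [folklore] **IN THE mm SLOT ONLY THE MULTIPLIER PACK SURVIVES** (every pack): `NlegK n Ga Cm a′ x y (inr m′) (inr l) = 2·embC n (a′•idK − Cm) x y m′ l`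
(`Gp`, `sandP`, `HRp` have no multiplier rows; `HRbp` has no multiplier columns). -/
theorem NlegK_inr_inr (a' : ℝ) (x y : Fin 4 → ℤ) (m' l : Fin 4) :
    NlegK n Ga Cm a' x y (Sum.inr m') (Sum.inr l) = 2 * embC n (a' • idK - Cm) x y m' l := by
  have hGr : ∀ y (m : Fin 4) f, Gp Ga x y (Sum.inr m) f = 0 := fun y m f => by cases f <;> rfl
  have hGc : ∀ z f (l : Fin 4), Gp Ga z y f (Sum.inr l) = 0 := fun z f l => by cases f <;> rfl
  have h1 : sandP n Ga Cm x y (Sum.inr m') (Sum.inr l) = 0 := comp_inr_row_off (comp_inr_row_off hGr) y m' _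
  have h2 : HRp n Ga Cm x y (Sum.inr m') (Sum.inr l) = 0 := comp_inr_row_off hGr y m' _
  have h3 : HRbp n Ga Cm x y (Sum.inr m') (Sum.inr l) = 0 := comp_inr_col_off (comp_inr_col_off hGc) x _ l
  simp only [NlegK, Pi.add_apply, Pi.sub_apply, Pi.smul_apply, smul_eq_mul, h1, h2, h3, Gp_inr_inr, Cp_inr_inr, sub_zero, mul_zero, zero_add]

/-- [folklore] **THE mm BLOCK OF THE ROAD's N-LEG AT COARSE POINTS IS `−wΦ^{(n)}`**: `NlegRoad m a (n•y) (n•y′) (inr m′) (inr l) = −wΦ^{(n)} m′ l (y − y′)`,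
`n = m + 1` (`2·(a′·δ − Cun′)` with `a′ = a∕n⁸`, `Cun′ = ½·(2a∕n⁸·δ + wΦ)`; UNCONDITIONAL). -/
theorem NlegRoad_inr_inr_coarse (m : ℕ) (a : ℝ) (y y' : Fin 4 → ℤ) (m' l : Fin 4) :
    NlegRoad m a (((m + 1 : ℕ) : ℤ) • y) (((m + 1 : ℕ) : ℤ) • y') (Sum.inr m') (Sum.inr l)
      = -wΦ (d := 3) (N := m + 1) m' l (y - y') := by
  rw [NlegRoad, NlegK_inr_inr, embC_coarse]
  simp only [Pi.sub_apply, Pi.smul_apply, smul_eq_mul, idK_apply, multM_apply]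
  ring

/-- [folklore] **THE mm BLOCK's ENVELOPE AT COARSE POINTS**: `|NlegRoad m a (n•y) (n•y′) (inr m′) (inr l)| ≤ 2·n⁻⁸·c166Z 3·e^{−kappaZ 3·|y − y′|₁}`
(`CoarseLegJunction.abs_wΦ_le`; UNCONDITIONAL, d-only constants). -/
theorem abs_NlegRoad_inr_inr_coarse_le (m : ℕ) (a : ℝ) (y y' : Fin 4 → ℤ) (m' l : Fin 4) :
    |NlegRoad m a (((m + 1 : ℕ) : ℤ) • y) (((m + 1 : ℕ) : ℤ) • y') (Sum.inr m') (Sum.inr l)|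
      ≤ 2 * (((m + 1 : ℕ) : ℝ) ^ 8)⁻¹ * c166Z 3 * Real.exp (-(kappaZ 3) * l1 (y - y')) := by
  rw [NlegRoad_inr_inr_coarse, abs_neg]
  exact abs_wΦ_le (m + 1) m' l (y - y')

/-- [folklore] **«CUN-ENV» IN BLOCK CURRENCY**: the mm block of the road's N-leg decays on `ℤ⁴` —
`Decays (blk (NlegRoad m a) false false) (2·n⁻⁸·c166Z 3) (kappaZ 3 ∕ n)` (zero off `n•ℤ⁴`; on it `|x − y|₁ = n·|quo x − quo y|₁`).  UNCONDITIONAL. -/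
theorem decays_blk_NlegRoad_mm (m : ℕ) (a : ℝ) :
    Decays (blk (NlegRoad m a) false false) (2 * (((m + 1 : ℕ) : ℝ) ^ 8)⁻¹ * c166Z 3) (kappaZ 3 / ((m + 1 : ℕ) : ℝ)) := by
  intro x y m' l
  show |NlegRoad m a x y (Sum.inr m') (Sum.inr l)| ≤ _
  have hC : 0 ≤ 2 * (((m + 1 : ℕ) : ℝ) ^ 8)⁻¹ * c166Z 3 := by
    have h := abs_wΦ_le (m + 1) m' l 0
    have : (0 : ℝ) ≤ 2 * (((m + 1 : ℕ) : ℝ) ^ 8)⁻¹ * c166Z 3 * Real.exp (-(kappaZ 3) * l1 (0 : Site 4)) := (abs_nonneg _).trans h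
    exact (mul_nonneg_iff_of_pos_right (Real.exp_pos _)).1 this
  by_cases hx : Torus.proj (m + 1) x = 0
  · by_cases hy : Torus.proj (m + 1) y = 0
    · have e := l1_sub_of_proj (m + 1) hx hy
      conv_lhs => rw [eq_zsmul_quo_of_proj (N := m + 1) hx, eq_zsmul_quo_of_proj (N := m + 1) hy]
      refine (abs_NlegRoad_inr_inr_coarse_le m a _ _ m' l).trans (le_of_eq ?_)
      rw [e]
      congr 1
      have hn : ((m + 1 : ℕ) : ℝ) ≠ 0 := Nat.cast_ne_zero.2 (Nat.succ_ne_zero m)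
      field_simp
    · rw [NlegRoad_inr_col_off m a x hy, abs_zero]
      exact mul_nonneg hC (Real.exp_pos _).le
  · rw [NlegRoad_inr_row_off m a hx, abs_zero]
    exact mul_nonneg hC (Real.exp_pos _).le

end MM

/-! ## §3 The fm block of the road's N-leg: `wH^{(n)}`, power `n⁻⁵`, decay on the block scale (mod `h12 ∧ h126`) -/

section FM

variable (m : ℕ) {a : ℝ} (ha : 0 < a)
include ha

/-- [folklore] **«WH-ENV» AT THE ROAD's LEGS, COARSE COLUMNS**: modulo [B5, Prop. 1.2] ∧ [B5, (1.126)–(1.127)] BY NAME (the read-out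
`RWeightedLegPack.NlegRoad_inl_inr_coarse`'s only hypotheses), for every fine `x`, coarse `y₀` and colours `κ l`:
`|NlegRoad m a x (n•y₀) (inl κ) (inr l)| ≤ (n⁵)⁻¹ · (MG163 4 · periodConst (kappa163 4) 3) · e^{−(kappa163 4∕4)·‖⌊x∕n⌋ − y₀‖∞}` — road FP's
`FP.CompositeMinimiserDecay.abs_wH_le` (UNCONDITIONAL, d-only constants) read through the dictionary line `NlegRoad … = wH^{(n)} κ l (x − n•y₀)`. -/
theorem abs_NlegRoad_inl_inr_coarse_le (h12 : B5.Prop12Printed (fam nOf hn1 MOf a ha)) (h126 : B5.Kernel126_127Printed (kfam nOf MOf))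
    (x y₀ : Fin 4 → ℤ) (κ l : Fin 4) :
    |NlegRoad m a x (((m + 1 : ℕ) : ℤ) • y₀) (Sum.inl κ) (Sum.inr l)|
      ≤ ((((m + 1 : ℕ) : ℝ)) ^ (3 + 2))⁻¹ * (MG163 (3 + 1) * periodConst (kappa163 (3 + 1)) 3)
          * Real.exp (-(kappa163 (3 + 1) / (3 + 1) * supNorm (quotOf (m + 1) x - y₀))) := by
  rw [NlegRoad_inl_inr_coarse m ha h12 h126]
  exact abs_wH_le (d := 3) (m + 1) (Nat.le_add_left 1 m) κ l x y₀

end FM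

section Scale

variable (m : ℕ)

/-- [folklore] From the block scale to the fine `ℓ¹` distance: for `n = m + 1`, every fine `x` and coarse `y₀`,
`e^{−c·‖⌊x∕n⌋ − y₀‖∞} ≤ e^{c}·e^{−(c∕(4n))·|x − n•y₀|₁}` (`|v|₁ ≤ 4‖v‖∞` on `ℤ⁴`, `|z|₁ ≤ n·|⌊z∕n⌋|₁ + 4n`, `⌊(x − n•y₀)∕n⌋ = ⌊x∕n⌋ − y₀`). -/
theorem exp_block_le_exp_fine {c : ℝ} (hc : 0 ≤ c) (x y₀ : Fin 4 → ℤ) :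
    Real.exp (-(c * supNorm (quotOf (m + 1) x - y₀)))
      ≤ Real.exp c * Real.exp (-(c / (4 * ((m + 1 : ℕ) : ℝ))) * l1 (x - ((m + 1 : ℕ) : ℤ) • y₀)) := by
  have hn : (0 : ℝ) < ((m + 1 : ℕ) : ℝ) := by exact_mod_cast Nat.succ_pos m
  -- the block index of `x − n•y₀` is `⌊x∕n⌋ − y₀`
  have hq : quo (m + 1) (x - ((m + 1 : ℕ) : ℤ) • y₀) = quotOf (m + 1) x - y₀ := by
    have h := quo_add_zsmul (N := m + 1) x (-y₀)
    rw [smul_neg, ← sub_eq_add_neg, ← sub_eq_add_neg] at h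
    exact h
  have h1 : l1 (quotOf (m + 1) x - y₀) ≤ ((3 : ℕ) + 1 : ℝ) * supNorm (quotOf (m + 1) x - y₀) :=
    l1_le_mul_supNorm (d := 3) _
  have h2 : l1 (x - ((m + 1 : ℕ) : ℤ) • y₀) ≤ ((m + 1 : ℕ) : ℝ) * l1 (quotOf (m + 1) x - y₀) + ((m + 1 : ℕ) : ℝ) * (3 + 1) := by
    have h := l1_le_l1_quo (N := m + 1) (d := 3) (x - ((m + 1 : ℕ) : ℤ) • y₀)
    rw [hq] at h
    exact_mod_cast h
  rw [← Real.exp_add]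
  apply Real.exp_le_exp.2
  have h3 : c / (4 * ((m + 1 : ℕ) : ℝ)) * l1 (x - ((m + 1 : ℕ) : ℤ) • y₀)
      ≤ c / (4 * ((m + 1 : ℕ) : ℝ)) * (((m + 1 : ℕ) : ℝ) * l1 (quotOf (m + 1) x - y₀) + ((m + 1 : ℕ) : ℝ) * (3 + 1)) :=
    mul_le_mul_of_nonneg_left h2 (by positivity)
  have h4 : c / (4 * ((m + 1 : ℕ) : ℝ)) * (((m + 1 : ℕ) : ℝ) * l1 (quotOf (m + 1) x - y₀) + ((m + 1 : ℕ) : ℝ) * (3 + 1))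
      = c / 4 * l1 (quotOf (m + 1) x - y₀) + c := by
    field_simp
    ring
  have h5 : c / 4 * l1 (quotOf (m + 1) x - y₀) ≤ c * supNorm (quotOf (m + 1) x - y₀) := by
    have := mul_le_mul_of_nonneg_left h1 (show (0 : ℝ) ≤ c / 4 by positivity)
    push_cast at this
    linarith
  linarith

end Scale

section FM2

variable (m : ℕ) {a : ℝ} (ha : 0 < a)
include ha

/-- [folklore] **«WH-ENV» IN FINE `ℓ¹` CURRENCY, EVERY COLUMN**: modulo `h12 ∧ h126`, for all fine `x w` and colours `κ l`,
`|NlegRoad m a x w (inl κ) (inr l)| ≤ (n⁵)⁻¹·C₄·e^{κ′}·e^{−(κ′∕(4n))·|x − w|₁}`, `κ′ = kappa163 4∕4`, `C₄ = MG163 4·periodConst (kappa163 4) 3`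
(columns off `n•ℤ⁴` vanish: `NlegRoad_inr_col_off`). -/
theorem abs_NlegRoad_inl_inr_le (h12 : B5.Prop12Printed (fam nOf hn1 MOf a ha)) (h126 : B5.Kernel126_127Printed (kfam nOf MOf))
    (x w : Fin 4 → ℤ) (κ l : Fin 4) :
    |NlegRoad m a x w (Sum.inl κ) (Sum.inr l)|
      ≤ ((((m + 1 : ℕ) : ℝ)) ^ (3 + 2))⁻¹ * (MG163 (3 + 1) * periodConst (kappa163 (3 + 1)) 3) * Real.exp (kappa163 (3 + 1) / (3 + 1))
          * Real.exp (-(kappa163 (3 + 1) / (3 + 1) / (4 * ((m + 1 : ℕ) : ℝ))) * l1 (x - w)) := by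
  have hκ : 0 ≤ kappa163 (3 + 1) / (3 + 1) := by have := kappa163_pos (3 + 1); positivity
  have hC : 0 ≤ ((((m + 1 : ℕ) : ℝ)) ^ (3 + 2))⁻¹ * (MG163 (3 + 1) * periodConst (kappa163 (3 + 1)) 3) := by
    -- nonnegativity read off the bound itself at a coarse column
    have h := abs_NlegRoad_inl_inr_coarse_le m ha h12 h126 0 0 κ l
    exact (mul_nonneg_iff_of_pos_right (Real.exp_pos _)).1 ((abs_nonneg _).trans h)
  by_cases hw : Torus.proj (m + 1) w = 0
  · have ew := eq_zsmul_quo_of_proj (N := m + 1) hw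
    rw [ew]
    refine (abs_NlegRoad_inl_inr_coarse_le m ha h12 h126 x (quo (m + 1) w) κ l).trans ?_
    rw [mul_assoc (_ * _) (Real.exp _), ← ew]
    refine mul_le_mul_of_nonneg_left ?_ hC
    have h := exp_block_le_exp_fine m hκ x (quo (m + 1) w)
    rw [← ew] at h
    exact h
  · rw [NlegRoad_inr_col_off m a x hw, abs_zero]
    exact mul_nonneg (mul_nonneg hC (Real.exp_pos _).le) (Real.exp_pos _).le

/-- [folklore] **«WH-ENV» IN BLOCK CURRENCY**: modulo `h12 ∧ h126`, the fm block of the road's N-leg decays on `ℤ⁴` at rate `κ′∕(4n)` with constant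
`(n⁵)⁻¹·C₄·e^{κ′}` — `Decays (blk (NlegRoad m a) true false) ((n⁵)⁻¹·C₄·e^{κ′}) (κ′∕(4n))`. -/
theorem decays_blk_NlegRoad_fm (h12 : B5.Prop12Printed (fam nOf hn1 MOf a ha)) (h126 : B5.Kernel126_127Printed (kfam nOf MOf)) :
    Decays (blk (NlegRoad m a) true false)
      (((((m + 1 : ℕ) : ℝ)) ^ (3 + 2))⁻¹ * (MG163 (3 + 1) * periodConst (kappa163 (3 + 1)) 3) * Real.exp (kappa163 (3 + 1) / (3 + 1)))
      (kappa163 (3 + 1) / (3 + 1) / (4 * ((m + 1 : ℕ) : ℝ))) :=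
  fun x w κ l => abs_NlegRoad_inl_inr_le m ha h12 h126 x w κ l

end FM2

/-! ## §4 The mf block by symmetry -/

section MF

variable (m : ℕ) {a : ℝ} (ha : 0 < a)
include ha

/-- [folklore] **THE mf BLOCK (`ℋ♭_R`) HAS THE SAME ENVELOPE**: modulo `h12 ∧ h126` (for `Spr (Ga (m+1) a)` and the read-out), the road's N-leg is
transpose-symmetric (`RWeightedLegPack.trK_NlegRoad`), so `Decays (blk (NlegRoad m a) false true) ((n⁵)⁻¹·C₄·e^{κ′}) (κ′∕(4n))`. -/
theorem decays_blk_NlegRoad_mf (h12 : B5.Prop12Printed (fam nOf hn1 MOf a ha)) (h126 : B5.Kernel126_127Printed (kfam nOf MOf)) :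
    Decays (blk (NlegRoad m a) false true)
      (((((m + 1 : ℕ) : ℝ)) ^ (3 + 2))⁻¹ * (MG163 (3 + 1) * periodConst (kappa163 (3 + 1)) 3) * Real.exp (kappa163 (3 + 1) / (3 + 1)))
      (kappa163 (3 + 1) / (3 + 1) / (4 * ((m + 1 : ℕ) : ℝ))) := by
  have hGa : Spr (GluonLeg.Ga (m + 1) a) := by
    obtain ⟨C, δ, hδ, h⟩ := spr_Ga_of_prop12 ha h12 h126 (m + 1)
    exact ⟨C, δ, hδ, h⟩
  have hsym := trK_NlegRoad m ha hGa
  intro x w κ l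
  show |NlegRoad m a x w (Sum.inr κ) (Sum.inl l)| ≤ _
  have e : NlegRoad m a x w (Sum.inr κ) (Sum.inl l) = NlegRoad m a w x (Sum.inl l) (Sum.inr κ) := by
    conv_lhs => rw [← hsym]
    rfl
  rw [e, l1_sub_symm x w]
  exact abs_NlegRoad_inl_inr_le m ha h12 h126 w x l κ

end MF

end Summit.QuantumFields.BalabanUV.Beta.D1BFx.RestLegEnvelopes

end
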